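import Summits.QuantumFields.BalabanUV.Beta.FP.KernelStepDressing
import Summits.QuantumFields.BalabanUV.Beta.FP.WoundEvenFamilyParities
import Summits.QuantumFields.BalabanUV.Beta.FP.PeriodisedBorderTables
import Summits.QuantumFields.BalabanUV.Beta.D1BFx.LiteralStencilSockets
import Summits.QuantumFields.BalabanUV.Beta.NVertexParitiesW
import Summits.QuantumFields.BalabanUV.Beta.GAN24.SecondOrderReadersParity

/-!
# `BalabanUV.Beta.FP.TowerFAnchorParities` — road «FP», binder row D1, ROUTE T (β1), (H5-F): **THE END's F-PARITIES `hVFm hVFt hWFm hWFt` AT STOREY 1 — the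
# `wStep Lc 1`-dressed LITERAL level-0 pair** (`TowerFAnchorRow`'s choice `𝒱F 1 := σ′₀•Lc⁴•dressV Lc Lc (wStep Lc 1) VG⁰`, `𝒲F 1 := σ′₀•Lc⁸•dressW … WG⁰`,
# `VG⁰ := vertexOfK (GcombSh Lc 0) Lc (JsB12CombSh⁰ … 0).S`, `WG⁰ := (JsB12CombSh⁰ … 0).W`): v10 `StepRecursionFeedNestedNamedI`'s binders `hVFm hVFt` (L.246–247)
# and `hWFm hWFt` (L.248–249) AT `n := 0`, for any torus and any index map landing in multiplier fibres — the storey-1 twins of `TowerFFamilyParities` ∕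
# `TowerFWoundParities`, from leaf BF-x's letters of the raw literal (`D1BFx/LiteralStencilSockets.JsB12CombSh0_S_an1_inr_inr ∕ _inl_inr`) and the row's
# `NVertexParitiesW.W2SymOfK_apply_eq_zero` pattern at an1's record `symTablesAn1S2`

WHY (located).  Road g58 A-3 ∕ FINDING FP-62 (journal [D1P3-G58-STAGED-7]): the END's F-tower must mirror `JcComp`'s three-way match; storey 1 is the dressed literal pair,
whose parities are NOT instances of the N-side files (those read `VN ∕ WN`).  With this file and `TowerFAnchorRow`, every F-letter the road instantiates in the END
has its storey-1 twin, and skeleton N closes `hF₁` by name without re-displaying `hVFm hVFt hWFm hWFt`.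

WHAT ([folklore] pointwise fibre bookkeeping BY NAME; no `def`, no `def … : Prop`, nothing cited, 0 sorry).  σ′₀ := `Sum.elim 1 (uF 0)`.
* §1 the literal's level-0 fibre blocks: `VG0_inr_inr` (`BubbleParity.vertexOfK_apply_eq_zero` ← leaf BF-x `JsB12CombSh0_S_an1_inr_inr`), `VG0_inl_inr_transpose`
  (`CombHId1Letters.vertexOfK_apply` ← `JsB12CombSh0_S_an1_inl_inr`), **`WG0_inr_inr`** (the raw literal's second-order family IS an1's swap-symmetrised carrier `W2SymOfK`
  at level 0 — `ChartStepJets.WchartOf_GcombSh ∕ WchartOf_eq`, `RecursiveWSlot.WrecOf_eq`, all `rfl` — and every level-0 table of `symTablesAn1S2` is mm-free: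
  `symTablesAn1S2_V_inr_inr`, `symHessFFAt_inr` (through `M1Of_apply`), lit `wilsonW₂_inr_inr`, `symVh₂SAn1_inr_inr`, `symTablesAn1S2_mixFF_inr`; the row's
  `W2SymOfK_apply_eq_zero`); the dressed versions `dressV_apply_inr_inr_G0 ∕ dressV_inl_inr_transpose_G0 ∕ dressW_apply_inr_inr_G0` and the END's σ′₀-scaled families
  `FZero_inr_inr ∕ FZero_inl_inr_eq_transpose ∕ FZeroW_inr_inr`.
* §2 **`hVFm_zero ∕ hVFt_zero`** (v10 L.246∕247 at `n := 0` under σ₀, torus and index map generic — the END feeds `fFRec Lc (Mc B) 0 ∕ hmF_rec Lc Mc 0 B`):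
  road `PeriodisedBorderTables.perZ_dper_symm` on a block-symmetrised kernel, as in `TowerFFamilyParities`.
* §3 **`hWFm_zero ∕ hWFt_zero`** (v10 L.248∕249 at `n := 0`, at the WOUND EVEN half `x z a b ↦ Σ'_e (𝒲F 1 μ y ν (y′ + Mb•e))♮ x z a b`, `♮ = ½•(· + sgnK (trK ·))`):
  road `WoundEvenFamilyParities.perF_dper_apply_eq_zero_of_inr_inr ∕ perF_dper_antitwin_fμ_of_parityEven` over `parityEven_tsum ∘ parityEven_evenHalf`.
WHAT THIS IS NOT: not the displayed box-side letters `hXF hLF hWFw hHF₁ hQF₁ hHF₂ hQF₂` at storey 1; nothing of Bałaban's asserted, valued or discharged; 0 estimates;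
v10 ∕ END NOT filed (policy); 0∕4 row-D1 binders; NOT (C1), NOT (T-ID), NOT D1, NEVER «G-an2-4 closed», NOT BetaPertH, NOT continuum, NOT Clay.
HONEST DEPENDENCY (page 1, mandatory): continuum YM on T⁴ ⇐ BetaPertH ∧ nine spine estimates (0/9 proved); BetaPertH ⇐ (D1) ∧ (D4) ∧ CAP+tail;
G-an2-4 gates asym, D1 and NE2/3/4.  HONEST FRAMING (cell contract, verbatim): «discharging `BetaPertH` makes Bałaban's UV stability UNCONDITIONAL —
a real constructive-QFT result; it is NOT the continuum limit and NOT the Clay problem.»  ABSOLUTE RULE (cell charter, verbatim): «No internally-minted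
statement may enter as a cited fact. Every hypothesis is either kernel-proved in this package or a verbatim quotation of a PUBLISHED theorem with page
reference. The manuscript(s) under audit are NOT citable for their own disputed steps — they are the thing under adjudication; programme-internal
(2001/route/tribunal) claims are never citable.»  Road «FP» OWNER, b2b-balaban-beta-d1-p3 gen 58, 2026-08-29.  No existing file touched.
-/

noncomputable section

open scoped BigOperators

namespace Summit.QuantumFields.BalabanUV.Beta.FP.TowerFAnchorParities

open Literature.MathematicalPhysics.QuantumFieldTheory.Balaban1983to89
open Literature.MathematicalPhysics.QuantumFieldTheory.Balaban1983to89.Beta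
open B4TorusKernel.MultiPeriod (translate)
open B6Lemma24Torus (pbox)
open ExpKernelCalculus (Site MKer)
open DressedMomentNormalisation (EKer)
open HessKerRate (scaleK scaleK_apply)
open HessianTelescopingKKT (wStep)
open OneStepResolventKernel (Fib)
open OneStepKernelFamily (vertexOfK)
open StepJetData (wilsonA)
open WilsonBiStencil (wilsonW₂ wilsonW₂_inr_inr)
open BalabanStepW2 (M2Of)
open SecondOrderResponse (W2SymOfK)
open Summit.QuantumFields.BalabanUV.Beta.TameKernelCalculus (trK)
open Summit.QuantumFields.BalabanUV.Beta.BorderedHessian (sgnK)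
open Summit.QuantumFields.BalabanUV.Beta.BubbleParity (vertexOfK_apply_eq_zero)
open Summit.QuantumFields.BalabanUV.Beta.CombHId1Letters (vertexOfK_apply)
open Summit.QuantumFields.BalabanUV.Beta.SpineRooted (SpureRecOf SpureRecOf_zero_level WrecOf T2RecOf T2RecOf_zero_level WrecOf_eq M1Of M1Of_apply)
open Summit.QuantumFields.BalabanUV.Beta.ChartStepJets (WchartOf WchartOf_eq WchartOf_GcombSh)
open Summit.QuantumFields.BalabanUV.Beta.SymAveragingHessianCounts (symHessFFAt symHessFFAt_inr)
open Summit.QuantumFields.BalabanUV.Beta.SymSecondOrderTablesAn1 (symTablesAn1S2 symTablesAn1S2_M symTablesAn1S2_vh₂S symTablesAn1S2_mixFF symVh₂SAn1_inr_inr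
  symTablesAn1S2_mixFF_inr)
open Summit.QuantumFields.BalabanUV.Beta.CombChartStepJets (GcombSh JsB12CombSh0 JsB12CombSh0_eq JsComb0Of_W)
open Summit.QuantumFields.BalabanUV.Beta.D1BFx.LiteralStencilSockets (JsB12CombSh0_S_an1_inr_inr JsB12CombSh0_S_an1_inl_inr symTablesAn1S2_V_inr_inr)
open Summit.QuantumFields.BalabanUV.Beta.NVertexParitiesW (W2SymOfK_apply_eq_zero)
open Summit.QuantumFields.BalabanUV.Beta.GAN24.SecondOrderReadersParity (parityEven_evenHalf)
open Summit.QuantumFields.BalabanUV.Beta.FP.KernelPeriodisationFib (Idx perF perZ perF_apply perZ_apply)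
open Summit.QuantumFields.BalabanUV.Beta.FP.KernelPeriodisationFibLoc (dper dper_apply)
open Summit.QuantumFields.BalabanUV.Beta.FP.PeriodisedBorderTables (perZ_dper_symm)
open Summit.QuantumFields.BalabanUV.Beta.FP.KernelStepDressing (dressV dressW dressV_apply dressW_apply)
open Summit.QuantumFields.BalabanUV.Beta.FP.WoundEvenFamilyParities (parityEven_tsum inr_inr_tsum_eq_zero inr_inr_evenHalf_eq_zero
  perF_dper_apply_eq_zero_of_inr_inr perF_dper_antitwin_fμ_of_parityEven)

variable {Lc : ℕ} [NeZero Lc] (hLc : Odd Lc) (N : ℕ) (cΛ cB : ℝ)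

/-! ## §1 Pointwise fibre blocks of the literal's level-0 pair and of its dressing -/

section Pointwise

/-- [folklore] **THE LITERAL's LEVEL-0 FIRST-ORDER FAMILY HAS NO MULTIPLIER–MULTIPLIER BLOCK** (leaf BF-x `JsB12CombSh0_S_an1_inr_inr` through `vertexOfK_apply_eq_zero`). -/
theorem VG0_inr_inr (c : Fin (3 + 1)) (t x z : Site (3 + 1)) (m m' : Fin (3 + 1)) :
    vertexOfK (GcombSh (d := 3) Lc 0) Lc (JsB12CombSh0 hLc N (symTablesAn1S2 3 Lc cΛ) cΛ cB 0).S c t x z (Sum.inr m) (Sum.inr m') = 0 :=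
  vertexOfK_apply_eq_zero (K := GcombSh (d := 3) Lc 0) (N := Lc)
    (fun κ' u x' z' => JsB12CombSh0_S_an1_inr_inr hLc N cΛ cB 0 κ' u x' z' m m') c t x z

/-- [folklore] **ITS FIELD–MULTIPLIER ENTRY IS THE TRANSPOSED MULTIPLIER–FIELD ENTRY** (leaf BF-x `JsB12CombSh0_S_an1_inl_inr`, termwise in `vertexOfK_apply`). -/
theorem VG0_inl_inr_transpose (c : Fin (3 + 1)) (t x z : Site (3 + 1)) (α m : Fin (3 + 1)) :
    vertexOfK (GcombSh (d := 3) Lc 0) Lc (JsB12CombSh0 hLc N (symTablesAn1S2 3 Lc cΛ) cΛ cB 0).S c t x z (Sum.inl α) (Sum.inr m)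
      = vertexOfK (GcombSh (d := 3) Lc 0) Lc (JsB12CombSh0 hLc N (symTablesAn1S2 3 Lc cΛ) cΛ cB 0).S c t z x (Sum.inr m) (Sum.inl α) := by
  rw [vertexOfK_apply, vertexOfK_apply]
  simp only [JsB12CombSh0_S_an1_inl_inr]

/-- [folklore] **THE LITERAL's LEVEL-0 SECOND-ORDER FAMILY HAS NO MULTIPLIER–MULTIPLIER BLOCK**: it IS an1's swap-symmetrised carrier `W2SymOfK` at level 0 of the
comb-chart slot recursion over `symTablesAn1S2` (`rfl` chain), and every level-0 table there is mm-free (the row's `W2SymOfK_apply_eq_zero`). -/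
theorem WG0_inr_inr (μ : Fin (3 + 1)) (y : Site (3 + 1)) (ν : Fin (3 + 1)) (y' x z : Site (3 + 1)) (m m' : Fin (3 + 1)) :
    (JsB12CombSh0 hLc N (symTablesAn1S2 3 Lc cΛ) cΛ cB 0).W μ y ν y' x z (Sum.inr m) (Sum.inr m') = 0 := by
  rw [JsB12CombSh0_eq, JsComb0Of_W, ← WchartOf_GcombSh, WchartOf_eq, WrecOf_eq]
  refine W2SymOfK_apply_eq_zero (fun κ u x' z' => ?_) (fun ρ w x' z' => ?_) (fun κ u κ' u' x' z' => ?_) (fun κ u ρ w x' z' => ?_) μ y ν y' x z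
  · -- the PURE first-order member at level 0: Wilson + border, both mm-free
    simp only [SpureRecOf_zero_level, Pi.add_apply, Pi.smul_apply, smul_eq_mul, symTablesAn1S2_V_inr_inr, mul_zero, add_zero]
    exact mul_eq_zero_of_right _ rfl
  · -- the multiplier table `M1Of … symHessFFAt …`: ff-only
    rw [symTablesAn1S2_M, M1Of_apply, Pi.smul_apply, Pi.smul_apply, Pi.smul_apply, Pi.smul_apply, smul_eq_mul, symHessFFAt_inr, mul_zero]
  · -- the second field partials at level 0: `cE₂ • wilsonW₂ + cB • vh₂S`
    simp only [T2RecOf_zero_level, Pi.add_apply, Pi.smul_apply, smul_eq_mul, symTablesAn1S2_vh₂S, wilsonW₂_inr_inr, symVh₂SAn1_inr_inr, mul_zero, add_zero]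
  · -- the mixed partials `wM2 • mixFF`: ff-only
    simp only [M2Of, Pi.smul_apply, smul_eq_mul, symTablesAn1S2_mixFF_inr, mul_zero]

variable (L : ℕ) (w : EKer (3 + 1))

/-- [folklore] **NO MULTIPLIER–MULTIPLIER ENTRIES** survive the dressing of `VG⁰`. -/
theorem dressV_apply_inr_inr_G0 (μ : Fin (3 + 1)) (y x z : Site (3 + 1)) (m m' : Fin (3 + 1)) :
    dressV Lc L w (vertexOfK (GcombSh (d := 3) Lc 0) Lc (JsB12CombSh0 hLc N (symTablesAn1S2 3 Lc cΛ) cΛ cB 0).S) μ y x z (Sum.inr m) (Sum.inr m') = 0 := by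
  rw [dressV_apply]
  simp only [VG0_inr_inr, mul_zero, tsum_zero, Finset.sum_const_zero]

/-- [folklore] **THE DRESSED FAMILY INHERITS THE FIELD–MULTIPLIER TRANSPOSE SYMMETRY** of `VG⁰`. -/
theorem dressV_inl_inr_transpose_G0 (μ : Fin (3 + 1)) (y x z : Site (3 + 1)) (α m : Fin (3 + 1)) :
    dressV Lc L w (vertexOfK (GcombSh (d := 3) Lc 0) Lc (JsB12CombSh0 hLc N (symTablesAn1S2 3 Lc cΛ) cΛ cB 0).S) μ y x z (Sum.inl α) (Sum.inr m)
      = dressV Lc L w (vertexOfK (GcombSh (d := 3) Lc 0) Lc (JsB12CombSh0 hLc N (symTablesAn1S2 3 Lc cΛ) cΛ cB 0).S) μ y z x (Sum.inr m) (Sum.inl α) := by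
  rw [dressV_apply, dressV_apply]
  simp only [VG0_inl_inr_transpose]

/-- [folklore] **NO MULTIPLIER–MULTIPLIER ENTRIES** survive the double dressing of `WG⁰`. -/
theorem dressW_apply_inr_inr_G0 (μ : Fin (3 + 1)) (y : Site (3 + 1)) (ν : Fin (3 + 1)) (y' x z : Site (3 + 1)) (m m' : Fin (3 + 1)) :
    dressW Lc L w (JsB12CombSh0 hLc N (symTablesAn1S2 3 Lc cΛ) cΛ cB 0).W μ y ν y' x z (Sum.inr m) (Sum.inr m') = 0 := by
  rw [dressW_apply]
  simp only [WG0_inr_inr, mul_zero, tsum_zero, Finset.sum_const_zero]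

end Pointwise

/-! ## §2 The END's storey-1 families `scaleK σ′₀ σ′₀ (Lc⁴ • dressV …)` ∕ `scaleK σ′₀ σ′₀ (Lc⁸ • dressW …)` -/

section Family

variable (uF : ℕ → ℝ)

/-- [folklore] the END's storey-1 first-order family has no multiplier–multiplier entries. -/
theorem FZero_inr_inr (μ : Fin (3 + 1)) (y x z : Site (3 + 1)) (m m' : Fin (3 + 1)) :
  scaleK (Sum.elim (fun _ : Fin (3 + 1) => (1 : ℝ)) (fun _ : Fin (3 + 1) => (uF 0))) (Sum.elim (fun _ : Fin (3 + 1) => (1 : ℝ)) (fun _ : Fin (3 + 1) => (uF 0)))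
    ((Lc : ℝ) ^ 4 • dressV Lc Lc (wStep Lc 1) (vertexOfK (GcombSh (d := 3) Lc 0) Lc (JsB12CombSh0 hLc N (symTablesAn1S2 3 Lc cΛ) cΛ cB 0).S) μ y) x z (Sum.inr m) (Sum.inr m') = 0 := by
  rw [scaleK_apply]
  simp only [Pi.smul_apply, smul_eq_mul, dressV_apply_inr_inr_G0, mul_zero, zero_mul]

/-- [folklore] the END's storey-1 first-order family reads `(inl α, inr m)` at `(x, z)` as `(inr m, inl α)` at `(z, x)` (equal units on both legs). -/
theorem FZero_inl_inr_eq_transpose (μ : Fin (3 + 1)) (y x z : Site (3 + 1)) (α m : Fin (3 + 1)) :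
  scaleK (Sum.elim (fun _ : Fin (3 + 1) => (1 : ℝ)) (fun _ : Fin (3 + 1) => (uF 0))) (Sum.elim (fun _ : Fin (3 + 1) => (1 : ℝ)) (fun _ : Fin (3 + 1) => (uF 0)))
    ((Lc : ℝ) ^ 4 • dressV Lc Lc (wStep Lc 1) (vertexOfK (GcombSh (d := 3) Lc 0) Lc (JsB12CombSh0 hLc N (symTablesAn1S2 3 Lc cΛ) cΛ cB 0).S) μ y) x z (Sum.inl α) (Sum.inr m)
   = scaleK (Sum.elim (fun _ : Fin (3 + 1) => (1 : ℝ)) (fun _ : Fin (3 + 1) => (uF 0))) (Sum.elim (fun _ : Fin (3 + 1) => (1 : ℝ)) (fun _ : Fin (3 + 1) => (uF 0)))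
    ((Lc : ℝ) ^ 4 • dressV Lc Lc (wStep Lc 1) (vertexOfK (GcombSh (d := 3) Lc 0) Lc (JsB12CombSh0 hLc N (symTablesAn1S2 3 Lc cΛ) cΛ cB 0).S) μ y) z x (Sum.inr m) (Sum.inl α) := by
  rw [scaleK_apply, scaleK_apply]
  simp only [Pi.smul_apply, smul_eq_mul, Sum.elim_inl, Sum.elim_inr, dressV_inl_inr_transpose_G0]
  ring

/-- [folklore] the END's storey-1 second-order family has no `μμ` block. -/
theorem FZeroW_inr_inr (μ : Fin (3 + 1)) (y : Site (3 + 1)) (ν : Fin (3 + 1)) (y' x z : Site (3 + 1)) (m m' : Fin (3 + 1)) :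
  scaleK (Sum.elim (fun _ : Fin (3 + 1) => (1 : ℝ)) (fun _ : Fin (3 + 1) => (uF 0))) (Sum.elim (fun _ : Fin (3 + 1) => (1 : ℝ)) (fun _ : Fin (3 + 1) => (uF 0)))
    ((Lc : ℝ) ^ 8 • dressW Lc Lc (wStep Lc 1) (JsB12CombSh0 hLc N (symTablesAn1S2 3 Lc cΛ) cΛ cB 0).W μ y ν y') x z (Sum.inr m) (Sum.inr m') = 0 := by
  rw [scaleK_apply]
  simp only [Pi.smul_apply, smul_eq_mul, dressW_apply_inr_inr_G0, mul_zero, zero_mul]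

end Family

/-! ## §3 `hVFm hVFt` AT STOREY 1, in v10's binder texts at `n := 0` under σ₀ = {`(𝒱F 1)` ↦ the dressed literal family}, torus and index map generic -/

section RecordV

variable (Lc) (uF : ℕ → ℝ)

/-- [folklore] **`hVFm` AT STOREY 1** — v10 `StepRecursionFeedNestedNamedI.d1Tel_JcComp_ctr_namedI`'s binder `hVFm` (L.246) AT `n := 0` with `(𝒱F 1)` ↦ the σ′₀-scaled
`Lc⁴ •` dressed literal first-order family and the index map generic (landing in multiplier fibres): the periodised family VANISHES on two such indices. -/
theorem hVFm_zero {M : Fin (3 + 1) → ℕ} [∀ i, NeZero (M i)] {ι : Type*} (f : ι → Idx M (Fib 3)) (hf : ∀ a : ι, ∃ m : Fin (3 + 1), (f a).2 = Sum.inr m)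
   (μ : Fin (3 + 1)) (y : Fin (3 + 1) → ℤ) (a a' : ι) :
  (perF M (dper M ((fun μ y => scaleK (Sum.elim (fun _ : Fin (3 + 1) => (1 : ℝ)) (fun _ : Fin (3 + 1) => (uF 0))) (Sum.elim (fun _ : Fin (3 + 1) => (1 : ℝ)) (fun _ : Fin (3 + 1) => (uF 0))) ((Lc : ℝ) ^ 4 • dressV Lc Lc (wStep Lc 1) (vertexOfK (GcombSh (d := 3) Lc 0) Lc (JsB12CombSh0 hLc N (symTablesAn1S2 3 Lc cΛ) cΛ cB 0).S) μ y)) μ y))) (f a) (f a') = 0 := by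
  obtain ⟨m, hm⟩ := hf a
  obtain ⟨m', hm'⟩ := hf a'
  have ha : f a = ((f a).1, Sum.inr m) := Prod.ext rfl hm
  have ha' : f a' = ((f a').1, Sum.inr m') := Prod.ext rfl hm'
  rw [ha, ha', perF_apply]
  simp only [perZ_apply, dper_apply, FZero_inr_inr, tsum_zero]

/-- [folklore] **`hVFt` AT STOREY 1** — v10's binder `hVFt` (L.247) AT `n := 0` under the same σ₀: a field index against an index in a multiplier fibre reads the same
both ways (road `PeriodisedBorderTables.perZ_dper_symm` on the block-symmetrised kernel, as in `TowerFFamilyParities.hVFt_rec`). -/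
theorem hVFt_zero {M : Fin (3 + 1) → ℕ} [∀ i, NeZero (M i)] {ι : Type*} (f : ι → Idx M (Fib 3)) (hf : ∀ a : ι, ∃ m : Fin (3 + 1), (f a).2 = Sum.inr m)
   (μ : Fin (3 + 1)) (y : Fin (3 + 1) → ℤ) (b : ↥(pbox M) × Fin (3 + 1)) (a : ι) :
  (perF M (dper M ((fun μ y => scaleK (Sum.elim (fun _ : Fin (3 + 1) => (1 : ℝ)) (fun _ : Fin (3 + 1) => (uF 0))) (Sum.elim (fun _ : Fin (3 + 1) => (1 : ℝ)) (fun _ : Fin (3 + 1) => (uF 0))) ((Lc : ℝ) ^ 4 • dressV Lc Lc (wStep Lc 1) (vertexOfK (GcombSh (d := 3) Lc 0) Lc (JsB12CombSh0 hLc N (symTablesAn1S2 3 Lc cΛ) cΛ cB 0).S) μ y)) μ y))) (b.1, Sum.inl b.2) (f a)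
   = (perF M (dper M ((fun μ y => scaleK (Sum.elim (fun _ : Fin (3 + 1) => (1 : ℝ)) (fun _ : Fin (3 + 1) => (uF 0))) (Sum.elim (fun _ : Fin (3 + 1) => (1 : ℝ)) (fun _ : Fin (3 + 1) => (uF 0))) ((Lc : ℝ) ^ 4 • dressV Lc Lc (wStep Lc 1) (vertexOfK (GcombSh (d := 3) Lc 0) Lc (JsB12CombSh0 hLc N (symTablesAn1S2 3 Lc cΛ) cΛ cB 0).S) μ y)) μ y))) (f a) (b.1, Sum.inl b.2) := by
  obtain ⟨m, hm⟩ := hf a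
  have ha : f a = ((f a).1, Sum.inr m) := Prod.ext rfl hm
  have hsym : ∀ (x z : Site (3 + 1)) (α' m' : Fin (3 + 1)),
      scaleK (Sum.elim (fun _ : Fin (3 + 1) => (1 : ℝ)) (fun _ : Fin (3 + 1) => (uF 0))) (Sum.elim (fun _ : Fin (3 + 1) => (1 : ℝ)) (fun _ : Fin (3 + 1) => (uF 0)))
          ((Lc : ℝ) ^ 4 • dressV Lc Lc (wStep Lc 1) (vertexOfK (GcombSh (d := 3) Lc 0) Lc (JsB12CombSh0 hLc N (symTablesAn1S2 3 Lc cΛ) cΛ cB 0).S) μ y) x z (Sum.inl α') (Sum.inr m')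
        = scaleK (Sum.elim (fun _ : Fin (3 + 1) => (1 : ℝ)) (fun _ : Fin (3 + 1) => (uF 0))) (Sum.elim (fun _ : Fin (3 + 1) => (1 : ℝ)) (fun _ : Fin (3 + 1) => (uF 0)))
          ((Lc : ℝ) ^ 4 • dressV Lc Lc (wStep Lc 1) (vertexOfK (GcombSh (d := 3) Lc 0) Lc (JsB12CombSh0 hLc N (symTablesAn1S2 3 Lc cΛ) cΛ cB 0).S) μ y) z x (Sum.inr m') (Sum.inl α') :=
    fun x z α' m' => FZero_inl_inr_eq_transpose hLc N cΛ cB uF μ y x z α' m'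
  rw [ha, perF_apply, perF_apply]
  beta_reduce
  generalize scaleK (Sum.elim (fun _ : Fin (3 + 1) => (1 : ℝ)) (fun _ : Fin (3 + 1) => (uF 0))) (Sum.elim (fun _ : Fin (3 + 1) => (1 : ℝ)) (fun _ : Fin (3 + 1) => (uF 0)))
      ((Lc : ℝ) ^ 4 • dressV Lc Lc (wStep Lc 1) (vertexOfK (GcombSh (d := 3) Lc 0) Lc (JsB12CombSh0 hLc N (symTablesAn1S2 3 Lc cΛ) cΛ cB 0).S) μ y) = K at hsym ⊢
  let S : MKer (3 + 1) (Fib 3) := fun x z a' b' =>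
    match a', b' with
    | Sum.inl α', Sum.inr m₁ => K x z (Sum.inl α') (Sum.inr m₁)
    | Sum.inr m₁, Sum.inl α' => K z x (Sum.inl α') (Sum.inr m₁)
    | _, _ => 0
  have hS : ∀ (x z : Site (3 + 1)) (a' b' : Fib 3), S x z a' b' = S z x b' a' := by
    intro x z a' b'
    rcases a' with α' | m₁ <;> rcases b' with α'' | m₂ <;> rfl
  have e1 : perZ M (dper M K) ((b.1 : ↥(pbox M)) : Site (3 + 1)) (((f a).1 : ↥(pbox M)) : Site (3 + 1)) (Sum.inl b.2) (Sum.inr m)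
      = perZ M (dper M S) ((b.1 : ↥(pbox M)) : Site (3 + 1)) (((f a).1 : ↥(pbox M)) : Site (3 + 1)) (Sum.inl b.2) (Sum.inr m) := by
    simp only [perZ_apply, dper_apply]; rfl
  have e2 : perZ M (dper M K) (((f a).1 : ↥(pbox M)) : Site (3 + 1)) ((b.1 : ↥(pbox M)) : Site (3 + 1)) (Sum.inr m) (Sum.inl b.2)
      = perZ M (dper M S) (((f a).1 : ↥(pbox M)) : Site (3 + 1)) ((b.1 : ↥(pbox M)) : Site (3 + 1)) (Sum.inr m) (Sum.inl b.2) := by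
    simp only [perZ_apply, dper_apply, ← hsym]; rfl
  rw [e1, e2]
  exact perZ_dper_symm M hS _ _ _ _

end RecordV

/-! ## §4 `hWFm hWFt` AT STOREY 1, at the wound even half of the dressed literal second-order family -/

section RecordW

variable (Lc) (uF : ℕ → ℝ) {M : Fin (3 + 1) → ℕ} (Mb : Fin (3 + 1) → ℕ) {ι : Type*} (f : ι → Idx M (Fib 3))
  (hf : ∀ a : ι, ∃ m : Fin (3 + 1), (f a).2 = Sum.inr m)
include hf

/-- [folklore] **`hWFm` AT STOREY 1** — v10's binder `hWFm` (L.248) AT `n := 0` with `(𝒲bF 1) B` ↦ the WOUND EVEN half of the σ′₀-scaled `Lc⁸ •` dressed literal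
second-order family (box `Mb` for `Mc B`) and a generic multiplier-valued index map: on two such indices the periodised family VANISHES. -/
theorem hWFm_zero (μ : Fin (3 + 1)) (y : Fin (3 + 1) → ℤ) (ν : Fin (3 + 1)) (y' : Fin (3 + 1) → ℤ) (a a' : ι) :
  (perF M (dper M ((fun μ y ν y' => (fun x z a b => ∑' e : Site (3 + 1), ((1 / 2 : ℝ) • ((fun μ y ν y' => scaleK (Sum.elim (fun _ : Fin (3 + 1) => (1 : ℝ)) (fun _ : Fin (3 + 1) => (uF 0))) (Sum.elim (fun _ : Fin (3 + 1) => (1 : ℝ)) (fun _ : Fin (3 + 1) => (uF 0))) ((Lc : ℝ) ^ 8 • dressW Lc Lc (wStep Lc 1) (JsB12CombSh0 hLc N (symTablesAn1S2 3 Lc cΛ) cΛ cB 0).W μ y ν y')) μ y ν (translate Mb y' e) + sgnK (trK ((fun μ y ν y' => scaleK (Sum.elim (fun _ : Fin (3 + 1) => (1 : ℝ)) (fun _ : Fin (3 + 1) => (uF 0))) (Sum.elim (fun _ : Fin (3 + 1) => (1 : ℝ)) (fun _ : Fin (3 + 1) => (uF 0))) ((Lc : ℝ) ^ 8 • dressW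 Lc Lc (wStep Lc 1) (JsB12CombSh0 hLc N (symTablesAn1S2 3 Lc cΛ) cΛ cB 0).W μ y ν y')) μ y ν (translate Mb y' e))))) x z a b)) μ y ν y'))) (f a) (f a') = 0 :=
  perF_dper_apply_eq_zero_of_inr_inr M f hf
    (fun x z m m' => inr_inr_tsum_eq_zero _ (fun e x' z' m₁ m₂ => inr_inr_evenHalf_eq_zero
      (fun x'' z'' m₃ m₄ => FZeroW_inr_inr hLc N cΛ cB uF μ y ν (translate Mb y' e) x'' z'' m₃ m₄) x' z' m₁ m₂) x z m m') a a'

/-- [folklore] **`hWFt` AT STOREY 1** — v10's binder `hWFt` (L.249) AT `n := 0` under the same σ₀: the (field, multiplier) border is the ANTI-twin of the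
(multiplier, field) border (graded-evenness of the wound even half: road `parityEven_tsum` over GAN24 `parityEven_evenHalf`). -/
theorem hWFt_zero (μ : Fin (3 + 1)) (y : Fin (3 + 1) → ℤ) (ν : Fin (3 + 1)) (y' : Fin (3 + 1) → ℤ) (b : ↥(pbox M) × Fin (3 + 1)) (a : ι) :
  (perF M (dper M ((fun μ y ν y' => (fun x z a b => ∑' e : Site (3 + 1), ((1 / 2 : ℝ) • ((fun μ y ν y' => scaleK (Sum.elim (fun _ : Fin (3 + 1) => (1 : ℝ)) (fun _ : Fin (3 + 1) => (uF 0))) (Sum.elim (fun _ : Fin (3 + 1) => (1 : ℝ)) (fun _ : Fin (3 + 1) => (uF 0))) ((Lc : ℝ) ^ 8 • dressW Lc Lc (wStep Lc 1) (JsB12CombSh0 hLc N (symTablesAn1S2 3 Lc cΛ) cΛ cB 0).W μ y ν y')) μ y ν (translate Mb y' e) + sgnK (trK ((fun μ y ν y' => scaleK (Sum.elim (fun _ : Fin (3 + 1) => (1 : ℝ)) (fun _ : Fin (3 + 1) => (uF 0))) (Sum.elim (fun _ : Fin (3 + 1) => (1 : ℝ)) (fun _ : Fin (3 + 1) => (uF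 0))) ((Lc : ℝ) ^ 8 • dressW Lc Lc (wStep Lc 1) (JsB12CombSh0 hLc N (symTablesAn1S2 3 Lc cΛ) cΛ cB 0).W μ y ν y')) μ y ν (translate Mb y' e))))) x z a b)) μ y ν y'))) (b.1, Sum.inl b.2) (f a) = -((perF M (dper M ((fun μ y ν y' => (fun x z a b => ∑' e : Site (3 + 1), ((1 / 2 : ℝ) • ((fun μ y ν y' => scaleK (Sum.elim (fun _ : Fin (3 + 1) => (1 : ℝ)) (fun _ : Fin (3 + 1) => (uF 0))) (Sum.elim (fun _ : Fin (3 + 1) => (1 : ℝ)) (fun _ : Fin (3 + 1) => (uF 0))) ((Lc : ℝ) ^ 8 • dressW Lc Lc (wStep Lc 1) (JsB12CombSh0 hLc N (symTablesAn1S2 3 Lc cΛ) cΛ cB 0).W μ y ν y')) μ y ν (translate Mb y' e) + sgnK (trK ((fun μ y ν y' => scaleK (Sum.elim (fun _ : Fin (3 + 1) => (1 : ℝ)) (fun _ : Fin (3 + 1) => (uF 0))) (Sum.elim (fun _ : Fin (3 + 1) => (1 : ℝ)) (fun _ : Fin (3 + 1) => (uF 0))) ((Lc : ℝ) ^ 8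 • dressW Lc Lc (wStep Lc 1) (JsB12CombSh0 hLc N (symTablesAn1S2 3 Lc cΛ) cΛ cB 0).W μ y ν y')) μ y ν (translate Mb y' e))))) x z a b)) μ y ν y'))) (f a) (b.1, Sum.inl b.2)) :=
  perF_dper_antitwin_fμ_of_parityEven M f hf (parityEven_tsum _ fun _ => parityEven_evenHalf _) b a

end RecordW

end Summit.QuantumFields.BalabanUV.Beta.FP.TowerFAnchorParities

end
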